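import Literature.AlgebraicGeometry.Resolution.ResolutionOfSingularities
import Mathlib.RingTheory.Valuation.ValuationSubring
import Mathlib.RingTheory.RegularLocalRing.Defs
import Mathlib.RingTheory.Localization.AtPrime.Basic
import Mathlib.FieldTheory.IntermediateField.Adjoin.Defs
import Mathlib.FieldTheory.PurelyInseparable.Basic
import Mathlib.FieldTheory.Galois.Basic
import Mathlib.RingTheory.Smooth.Locus
import Mathlib.FieldTheory.IntermediateField.Adjoin.Algebra
import HarnessLib

/-!
# Local uniformization of valuations on algebraic function fields

Topic: `Literature/AlgebraicGeometry/Resolution`. Names the (weak, non-embedded) local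
uniformization predicate used verbatim by routes `ResolutionOfSingularities/Valuative` and
`ResolutionOfSingularities/CyclicCovers`, and vendors two published theorems saying that local
uniformization holds after a FINITE extension of the function field.

## Content

* `IsLocallyUniformizable k K O` — for a field extension `K/k` and a valuation ring `O` of `K`
  (containing `k`): there is a finitely generated `k`-subalgebra `A ⊆ O` with `Frac A = K` whose
  localisation at the centre `𝔪_O ∩ A` is a regular local ring (Zariski 1940; the "(P, ∅) is
  `k`-uniformizable" of Knaf–Kuhlmann 2009, §1, for Noetherian ground ring `k`). This is the WEAK
  form: no prescribed finite `Z ⊆ O` is required to lie in the local ring (Knaf–Kuhlmann's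
  "strongly uniformizable"), no embedded / simultaneous data.
* `LocalUniformizationInChar p` — every valuation ring over `k` of every finitely generated
  field extension `K/k` with `char k = p` is locally uniformizable. Open for prime `p` in
  transcendence degree `≥ 4`.
* `KnafKuhlmann2009` — NAMED FACT (Knaf–Kuhlmann 2009, Thm. 1.2, weak consequence): every place
  of a function field `F|K` admits local uniformization in a finite extension of `F`.
* `Temkin2013` — NAMED FACT (Temkin 2013, Thm. 1.3.2 "inseparable local uniformization", weak
  consequence): the finite extension can be taken purely inseparable.
* `Temkin2013Rel` — **refuted as stated, RETIRED from the fact debt and DEPRECATED**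
  (verdict clean-up 2026-08-15). It was the first rendering of the RELATIVE form of Temkin 2013,
  Thm. 1.3.2 (a prescribed affine model `X = Spec A` of `K°` is refined by an affine model
  `X' = Spec A'`, `A ≤ A'`, such that, for finite purely inseparable `l/k`, `L/lK`, the centre of
  the unique valuation ring `L°` over `K°` on the `L`-normalisation `Nr_L(X') = Spec (integral
  closure of A' in L)` is a simple `l`-smooth point). Its rendering of "simple" (arXiv:0804.1554v3
  p. 4: "a smooth point `x` on an `l`-variety is called simple if `k(x)` is separable over `l`";
  `k(x)/l` is a finitely generated, in general TRANSCENDENTAL extension) by Mathlib's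
  `Algebra.IsSeparable l k(𝔭)` — ALGEBRAIC and separable — is too strong, and the statement is
  false: kernel-checked refutation
  `Literature.AlgebraicGeometry.Resolution.not_temkin2013Rel : ¬ Temkin2013Rel` (companion module
  `InseparableLocalUniformization.lean`, witness `K = k(t)`, `O = K`; axioms `propext`,
  `Classical.choice`, `Quot.sound`, re-checked 2026-08-15). The CORRECTED statement is the named
  fact `Literature.AlgebraicGeometry.Resolution.Temkin2013Relative` of that module (same data,
  "simple" = `Algebra.FormallySmooth l k(𝔭)`, Matsumura CRT Thm. 26.9), with
  `Temkin2013Relative.temkin2013 : Temkin2013Relative → Temkin2013`; it lives downstream of this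
  file and is not re-declared here. The `def` is kept, statement byte-for-byte, only because its
  refutation names it, and carries `@[deprecated]`; no `Temkin2013Rel_holds` can exist; do not
  take `(h : Temkin2013Rel)` as a hypothesis. The vacuous implication
  `Temkin2013Rel.temkin2013 : Temkin2013Rel → Temkin2013` is likewise kept `@[deprecated]` (its
  meaningful replacement is `Temkin2013Relative.temkin2013`). API: `exists_affineModel` (every
  `K° ⊇ k` with `K/k` finitely generated has an affine model).

## Sources

* O. Zariski, *Local uniformization on algebraic varieties*, Ann. of Math. 41 (1940) 852–896.
* H. Knaf, F.-V. Kuhlmann, *Every place admits local uniformization in a finite extension of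
  the function field*, Adv. Math. 221 (2009) 428–453, §1 (uniformizable pairs `(P, Z)`),
  Thm. 1.2, Cor. 1.3. arXiv:math/0702856.
* M. Temkin, *Inseparable local uniformization*, J. Algebra 373 (2013) 65–119, Thm. 1.3.2,
  Cor. 1.3.3. arXiv:0804.1554.
* V. Cossart, O. Piltant, *Resolution of singularities of threefolds in positive
  characteristic I*, J. Algebra 320 (2008) 1051–1082 (reduction of resolution in dim 3 to local
  uniformization on Artin–Schreier and purely inseparable coverings).

## Rendering notes

* "`P` is centred in a regular point `x` of a `k`-model `X` of `F|k`" ↦ affine chart: a finitely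
  generated `k`-subalgebra `A ⊆ O_P` with fraction field `F`, regular after localising at the
  prime `𝔪_{O} ∩ A` (every model has an affine neighbourhood of the centre; conversely `Spec A`
  is a model).
* Knaf–Kuhlmann and Temkin conclude SMOOTHNESS over a finite purely inseparable extension
  `k'/k` of the ground field at the centre; smooth over a field ⇒ regular, and a finitely
  generated `k'`-algebra is a finitely generated `k`-algebra, so the weak regular form below is
  a consequence of the printed statements (it forgets `k'`, the monomialisation of `Z`, and the
  Galois / tame options of Knaf–Kuhlmann Thm. 1.2).
* Temkin's Thm. 1.3.2 data (arXiv:0804.1554, p. 3–4): "an affine model is given by a finitely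
  generated `k`-subalgebra `A ⊂ K°` with `Frac(A) = K`"; "a model `X'` refines `X`" = the
  isomorphism of generic points extends to a morphism `X' → X`, which for affine models inside
  `K` is `A ⊆ A'`; "`Nr_L(Spec A)` is `Spec` of the integral closure of `A` in `L`"; "a smooth
  point `x` on an `l`-variety is called simple if `k(x)` is separable over `l`". The pair of
  finite purely inseparable extensions `l/k`, `L/lK` is rendered as: `L/K` finite purely
  inseparable and `l` an intermediate field of `L/k`, finite purely inseparable over `k`
  (equivalent: `lK/K` is purely inseparable as it is generated by `l`, and pure inseparability
  is transitive / descends in towers). `Nr_L(A')` is quantified as an `l`-subalgebra `N` of `L`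
  whose underlying set is the integral closure (it contains `l`, which is integral over
  `k ⊆ A'`); that it is an affine `k`-model of `L°` (finitely generated, `Frac = L`) is implicit in
  the source ("`l`-variety") and recorded. Smoothness at the centre `𝔭 = 𝔪_{L°} ∩ N` is Mathlib's
  `Algebra.IsSmoothAt l 𝔭` (formal smoothness of `N_𝔭` over `l`; for algebras essentially of
  finite type this is smoothness at the point, Stacks 00TB); regularity of `N_𝔭` is recorded as
  well (smooth over a field ⇒ regular), exactly as in the weak `Temkin2013`.
* The finite extension `L/K` is quantified as a type with its instances
  (`∃ (L : Type u) (_ : Field L) (_ : Algebra K L) …`) so that consumers may `obtain` it and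
  `letI` the instances.
-/

noncomputable section

namespace Literature.AlgebraicGeometry.Resolution

universe u

/-- **(Weak) local uniformization of a valuation ring** `O` of `K` over `k` (Zariski 1940;
Knaf–Kuhlmann 2009, §1: "`P` is `k`-uniformizable"): some finitely generated `k`-subalgebra
`A ⊆ O` with `Frac A = K` is regular at the centre of `O`, i.e. the localisation of `A` at the
prime `𝔪_O ∩ A` is a regular local ring. [cite: KnafKuhlmann2009, Section 1] -/
def IsLocallyUniformizable (k K : Type u) [Field k] [Field K] [Algebra k K]
    (O : ValuationSubring K) : Prop :=
  ∃ (A : Subalgebra k K) (h : A.toSubring ≤ O.toSubring), A.FG ∧ IsFractionRing A K ∧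
    IsRegularLocalRing (Localization.AtPrime
      (Ideal.comap (Subring.inclusion h) (IsLocalRing.maximalIdeal O)))

/-- **Local uniformization in characteristic `p`** (`LU_p`; Zariski 1940 for `p = 0`; open for
prime `p` and `trdeg K/k ≥ 4`; Cossart–Piltant 2008/2009 for `trdeg ≤ 3`): for every field `k`
of characteristic `p`, every finitely generated field extension `K/k` and every valuation ring
`O` of `K` containing `k`, `O` is locally uniformizable over `k`. A `Prop` definition, not an
assertion. [cite: CossartPiltant2008, Introduction (the local uniformization problem)] -/
def LocalUniformizationInChar (p : ℕ) : Prop :=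
  ∀ (k K : Type u) [Field k] [CharP k p] [Field K] [Algebra k K], (⊤ : IntermediateField k K).FG →
    ∀ O : ValuationSubring K, (∀ c : k, algebraMap k K c ∈ O) → IsLocallyUniformizable k K O

/-- NAMED FACT — **Knaf–Kuhlmann: every place admits local uniformization in a finite
extension of the function field** (Knaf–Kuhlmann 2009, Thm. 1.2: "Let `P` be a place of the
function field `F|K` and let `Z ⊂ O_P` be a finite set. Let `𝒫` be an extension of `P` to the
algebraic closure of `F`. Then there exist a finite purely inseparable extension `𝒦|K` and a
finite separable extension `ℱ|F.𝒦` such that the pair `(𝒫|_ℱ, Z)` is smoothly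
`𝒦`-uniformizable"; `ℱ|F.𝒦` may be chosen Galois). Vendored as the WEAK consequence: for every
finitely generated `K/k` (any characteristic) and valuation ring `O ⊇ k` of `K` there is a
finite extension `L/K` and a valuation ring `O'` of `L` lying over `O` that is locally
uniformizable over `k`. Users take `(h : KnafKuhlmann2009)`. [cite: KnafKuhlmann2009, Thm. 1.2] -/
def KnafKuhlmann2009 : Prop :=
  ∀ (k K : Type u) [Field k] [Field K] [Algebra k K], (⊤ : IntermediateField k K).FG →
    ∀ O : ValuationSubring K, (∀ c : k, algebraMap k K c ∈ O) →
      ∃ (L : Type u) (_ : Field L) (_ : Algebra K L) (_ : Algebra k L) (_ : IsScalarTower k K L),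
        FiniteDimensional K L ∧
        ∃ O' : ValuationSubring L, O'.comap (algebraMap K L) = O ∧ IsLocallyUniformizable k L O'

/-- NAMED FACT — **Temkin's inseparable local uniformization** (Temkin 2013, Thm. 1.3.2: "Let
`K/k` be a finitely generated field extension, `K°` a valuation ring of `K` containing `k` and
`X` an affine `k`-model of `K°`. Then there exist finite purely inseparable extensions `l/k` and
`L/lK` and an affine model `X'` of `K°` such that `X'` refines `X` and the unique extension of
`K°` to a valuation ring of `L` is centred on a simple `l`-smooth point of the `L`-normalisation
`Nr_L(X')`"). Vendored as the WEAK consequence: for every finitely generated `K/k` and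
valuation ring `O ⊇ k` of `K` there is a finite purely inseparable extension `L/K` and a
valuation ring `O'` of `L` over `O` (necessarily the unique one) that is locally uniformizable
over `k` (`Nr_L(X')` is of finite type over `k` since finitely generated `k`-algebras are
universally Japanese; `l`-smooth ⇒ regular). The refinement of a prescribed model `X` is
forgotten. Users take `(h : Temkin2013)`. [cite: Temkin2013, Thm. 1.3.2] -/
def Temkin2013 : Prop :=
  ∀ (k K : Type u) [Field k] [Field K] [Algebra k K], (⊤ : IntermediateField k K).FG →
    ∀ O : ValuationSubring K, (∀ c : k, algebraMap k K c ∈ O) →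
      ∃ (L : Type u) (_ : Field L) (_ : Algebra K L) (_ : Algebra k L) (_ : IsScalarTower k K L),
        FiniteDimensional K L ∧ IsPurelyInseparable K L ∧
        ∃ O' : ValuationSubring L, O'.comap (algebraMap K L) = O ∧ IsLocallyUniformizable k L O'

/-- The **centre** of a valuation ring `O'` of `L` on a subalgebra `N ⊆ O'`: the prime ideal
`𝔪_{O'} ∩ N` of `N`. [folklore] -/
def centreIdeal {F L : Type u} [Field F] [Field L] [Algebra F L] (N : Subalgebra F L)
    (O' : ValuationSubring L) (h : N.toSubring ≤ O'.toSubring) : Ideal N :=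
  Ideal.comap (Subring.inclusion h : ↥N →+* ↥O') (IsLocalRing.maximalIdeal O')

/-- The centre is a prime ideal (preimage of the maximal ideal of `O'`). [folklore] -/
instance centreIdeal.isPrime {F L : Type u} [Field F] [Field L] [Algebra F L] (N : Subalgebra F L)
    (O' : ValuationSubring L) (h : N.toSubring ≤ O'.toSubring) : (centreIdeal N O' h).IsPrime :=
  Ideal.comap_isPrime _ _

/-- **DEPRECATED — refuted as stated; retired from the fact debt (verdict clean-up
2026-08-15). Kept byte-for-byte only because its refutation `not_temkin2013Rel` names it.**
The first rendering of **Temkin's inseparable local uniformization, relative form** (Temkin 2013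
= arXiv:0804.1554v3, Thm. 1.3.2, p. 3: "Let `K/k` be a finitely generated field extension, `K°`
be a valuation ring of `K` containing `k` and `X` be an affine `k`-model of `K°`. Then there exist
finite purely inseparable extensions `l/k` and `L/lK` and an affine model `X'` of `K°` such that
`X'` refines `X` and the unique extension of `K°` to a valuation ring of `L` is centered on a
simple `l`-smooth point of the `L`-normalization `Nr_L(X')`"; p. 4: `Nr_L(Spec A)` is `Spec` of
the integral closure of `A` in `L`, and "a smooth point `x` on an `l`-variety is called simple if
`k(x)` is separable over `l`"). Rendering (see the module docstring): `X = Spec A`, `X' = Spec A'`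
with `A ≤ A' ≤ K°` finitely generated `k`-subalgebras with fraction field `K`; `L/K` finite purely
inseparable, `l ≤ L` finite purely inseparable over `k`; `L° = O'` the valuation ring of `L` over
`K°`; `N` the `l`-subalgebra of `L` with underlying set the integral closure of `A'` in `L`,
`N ⊆ L°`, an affine model of `L°` (finitely generated over `k`, `Frac N = L`); at the centre
`𝔭 = 𝔪_{L°} ∩ N`: `N_𝔭` is `l`-smooth (`Algebra.IsSmoothAt l 𝔭`) with residue field separable
over `l` (simple), and regular.
**What is wrong:** "separable over `l`" of the finitely generated, in general TRANSCENDENTAL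
residue field extension `k(𝔭)/l` was rendered as `Algebra.IsSeparable l k(𝔭)`, which in Mathlib
entails `Algebra.IsAlgebraic`. For `K = k(t)`, `O = K` (height `0`) one gets `L° = L`, `𝔭 = ⊥`,
`k(𝔭) ⊇ N` with fraction field `L ∋ t` transcendental over the finite extension `l/k` —
contradiction; the same happens for every `O` whose residue field is transcendental over `k`.
The printed theorem is not affected. **Refutation (kernel-checked, kept):**
`Literature.AlgebraicGeometry.Resolution.not_temkin2013Rel : ¬ Temkin2013Rel`
(`Literature/AlgebraicGeometry/Resolution/InseparableLocalUniformization.lean`, every universe,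
witness `k = ULift ℚ`, `K = RatFunc k`, `O = ⊤`; axioms `propext`, `Classical.choice`,
`Quot.sound`). **Corrected statement — use instead:** the named fact
`Literature.AlgebraicGeometry.Resolution.Temkin2013Relative` of the same companion module (this
statement with the single correction "simple" = `Algebra.FormallySmooth l k(𝔭)`, i.e.
separability = `0`-smoothness of an arbitrary field extension, Matsumura, CRT, Thm. 26.9; its
conclusion is `Temkin2013RelConclusion k K O A`), together with
`Temkin2013Relative.temkin2013 : Temkin2013Relative → Temkin2013`. It lives downstream of this
file and is deliberately not re-declared here (it would duplicate that declaration); no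
`Temkin2013Rel_holds` can exist; do NOT take `(h : Temkin2013Rel)` as a hypothesis.
[cite: Temkin2013, Thm. 1.3.2 (arXiv:0804.1554v3 p. 3) with "simple" of p. 4 MIS-RENDERED as algebraic separability; refuted rendering, kept deprecated] -/
@[deprecated "refuted as stated: see Literature.AlgebraicGeometry.Resolution.not_temkin2013Rel \
  (InseparableLocalUniformization.lean); corrected statement: \
  Literature.AlgebraicGeometry.Resolution.Temkin2013Relative (same module; \
  Temkin2013Relative.temkin2013 recovers Temkin2013)" (since := "2026-08-15")]
def Temkin2013Rel : Prop :=
  ∀ (k K : Type u) [Field k] [Field K] [Algebra k K], (⊤ : IntermediateField k K).FG →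
    ∀ O : ValuationSubring K, (∀ c : k, algebraMap k K c ∈ O) →
    ∀ A : Subalgebra k K, A.toSubring ≤ O.toSubring → A.FG → IsFractionRing A K →
      ∃ (L : Type u) (_ : Field L) (_ : Algebra K L) (_ : Algebra k L) (_ : IsScalarTower k K L),
        FiniteDimensional K L ∧ IsPurelyInseparable K L ∧
        ∃ l : IntermediateField k L, FiniteDimensional k l ∧ IsPurelyInseparable k l ∧
        ∃ (A' : Subalgebra k K), A ≤ A' ∧ A'.toSubring ≤ O.toSubring ∧ A'.FG ∧
          IsFractionRing A' K ∧
        ∃ O' : ValuationSubring L, O'.comap (algebraMap K L) = O ∧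
        ∃ (N : Subalgebra l L) (hN : N.toSubring ≤ O'.toSubring),
          (N : Set L) = {x : L | IsIntegral (A'.map (IsScalarTower.toAlgHom k K L)) x} ∧
          (N.restrictScalars k).FG ∧ IsFractionRing N L ∧
          Algebra.IsSmoothAt l (centreIdeal N O' hN) ∧
          Algebra.IsSeparable l
            (IsLocalRing.ResidueField (Localization.AtPrime (centreIdeal N O' hN))) ∧
          IsRegularLocalRing (Localization.AtPrime (centreIdeal N O' hN))

/-! ## API -/

/-- Temkin's purely inseparable form implies the Knaf–Kuhlmann weak form (forget pure
inseparability). [folklore] -/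
theorem Temkin2013.knafKuhlmann2009 (h : Temkin2013.{u}) : KnafKuhlmann2009.{u} := by
  intro k K _ _ _ hfg O hO
  obtain ⟨L, iF, iA, iA', iT, hfin, -, O', hO', hLU⟩ := h k K hfg O hO
  exact ⟨L, iF, iA, iA', iT, hfin, O', hO', hLU⟩

/-- If local uniformization holds in characteristic `p`, it holds trivially "after a finite
extension" with `L = K`. [folklore] -/
theorem LocalUniformizationInChar.self {p : ℕ} (h : LocalUniformizationInChar.{u} p)
    (k K : Type u) [Field k] [CharP k p] [Field K] [Algebra k K]
    (hfg : (⊤ : IntermediateField k K).FG) (O : ValuationSubring K)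
    (hO : ∀ c : k, algebraMap k K c ∈ O) :
    ∃ O' : ValuationSubring K, O'.comap (algebraMap K K) = O ∧ IsLocallyUniformizable k K O' := by
  refine ⟨O, ?_, h k K hfg O hO⟩
  ext x
  simp

/-- Every valuation ring `O ⊇ k` of a finitely generated extension `K/k` has an **affine model**:
a finitely generated `k`-subalgebra `A ⊆ O` with `Frac A = K` (invert the field generators not
in `O`). [folklore] -/
theorem exists_affineModel (k K : Type u) [Field k] [Field K] [Algebra k K]
    (hfg : (⊤ : IntermediateField k K).FG) (O : ValuationSubring K)
    (hO : ∀ c : k, algebraMap k K c ∈ O) :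
    ∃ A : Subalgebra k K, A.toSubring ≤ O.toSubring ∧ A.FG ∧ IsFractionRing A K := by
  classical
  obtain ⟨t, ht⟩ := hfg
  -- replace each generator `x ∉ O` by `x⁻¹ ∈ O`
  let f : K → K := fun x => if x ∈ O then x else x⁻¹
  let s : Finset K := t.image f
  have hsO : ∀ y ∈ s, y ∈ O := by
    intro y hy
    obtain ⟨x, -, rfl⟩ := Finset.mem_image.mp hy
    by_cases hx : x ∈ O
    · simp [f, hx]
    · simpa [f, hx] using (O.mem_or_inv_mem x).resolve_left hx
  -- `O` as a `k`-subalgebra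
  let Oalg : Subalgebra k K :=
    { O.toSubring with algebraMap_mem' := hO }
  let A : Subalgebra k K := Algebra.adjoin k (s : Set K)
  have hAO : A ≤ Oalg := Algebra.adjoin_le (fun y hy => hsO y hy)
  have ht_sub : (t : Set K) ⊆ (IntermediateField.adjoin k (s : Set K) : Set K) := by
    intro x hx
    have hfx : f x ∈ IntermediateField.adjoin k (s : Set K) :=
      IntermediateField.subset_adjoin k _ (Finset.mem_image_of_mem f (Finset.mem_coe.mp hx))
    by_cases hxO : x ∈ O
    · simpa [f, hxO] using hfx
    · have : x⁻¹ ∈ IntermediateField.adjoin k (s : Set K) := by simpa [f, hxO] using hfx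
      simpa using inv_mem this
  have htop : IntermediateField.adjoin k (s : Set K) = ⊤ := by
    apply top_le_iff.mp
    rw [← ht]
    exact IntermediateField.adjoin_le_iff.mpr ht_sub
  refine ⟨A, fun x hx => hAO hx, Subalgebra.fg_adjoin_finset s, ?_⟩
  refine IsFractionRing.of_field A K fun z => ?_
  have hz : z ∈ IntermediateField.adjoin k (s : Set K) := by rw [htop]; trivial
  obtain ⟨x, hx, y, hy, rfl⟩ := IntermediateField.mem_adjoin_iff_div.mp hz
  exact ⟨⟨x, hx⟩, ⟨y, hy⟩, rfl⟩

-- names the `@[deprecated]` record `Temkin2013Rel` on purpose: the vacuous implication is kept, deprecated,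
-- so that this module's declared names are unchanged (verdict clean-up 2026-08-15); REMOVE-WHEN `Temkin2013Rel`
-- is deleted
set_option linter.deprecated false in
/-- **DEPRECATED — vacuous** (its hypothesis `Temkin2013Rel` is refuted, `not_temkin2013Rel` in
`InseparableLocalUniformization.lean`; the meaningful implication is
`Temkin2013Relative.temkin2013` there, from the corrected relative form). The (mis-rendered)
relative form implies the weak absolute form `Temkin2013` (choose any affine model of `K°`, keep
`L`, `O'` and `Nr_L(X')` as the uniformizing chart). Kept, statement and proof unchanged, only so
that this module keeps declaring every name it declared. [folklore] -/
@[deprecated "vacuous (the hypothesis Temkin2013Rel is refuted: \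
  Literature.AlgebraicGeometry.Resolution.not_temkin2013Rel); use \
  Literature.AlgebraicGeometry.Resolution.Temkin2013Relative.temkin2013 \
  (InseparableLocalUniformization.lean)" (since := "2026-08-15")]
theorem Temkin2013Rel.temkin2013 (h : Temkin2013Rel.{u}) : Temkin2013.{u} := by
  intro k K _ _ _ hfg O hO
  obtain ⟨A, hAO, hAfg, hAfr⟩ := exists_affineModel k K hfg O hO
  obtain ⟨L, iF, iA, iA', iT, hfin, hpi, l, -, -, A', -, -, -, -, O', hO', N, hN, -, hNfg, hNfr,
    -, -, hreg⟩ := h k K hfg O hO A hAO hAfg hAfr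
  exact ⟨L, iF, iA, iA', iT, hfin, hpi, O', hO', N.restrictScalars k, hN, hNfg, hNfr, hreg⟩

end Literature.AlgebraicGeometry.Resolution

end
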